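import Mathlib
import Summits.ValiantsHypothesis.ValiantsHypothesis.Theses.BinomialElusive
import Summits.ValiantsHypothesis.ValiantsHypothesis.Theorems.NewtonUnitEquationsTwoProductsRaySeries

/-!
# BinomialElusive — `ToricBinomialElusive` (item stmt-ValiantsHypothesis-7394)

Binomial curves `x ↦ (x^{a_i} + x^{a_i + c_i})_{i < m}` with pairwise distinct positive gaps `c_i`
elude every MONOMIAL map `Γ : ℂ^s → ℂ^m` (each coordinate `Γ_i = κ_i z^{e_i}` has at most one
monomial) from fewer than `m` variables, whatever the degree.

Proof (elementary, no polynomial identities needed).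
* `Γ_i(y) = κ_i ∏_j y_j^{e_ij}`; the point `x = 1` of the curve forces `κ_i ≠ 0`.
* Since `s < m`, the strong rank condition for `ℤ` gives `λ : Fin m → ℤ`, `λ ≠ 0`, in the left
  kernel of the exponent matrix: `∑_i λ_i e_ij = 0` for every `j`; hence the natural vectors
  `λ⁺ = toNat ∘ λ`, `λ⁻ = toNat ∘ (-λ)` have `∑_i e_ij λ⁺_i = ∑_i e_ij λ⁻_i =: v_j`.
* Let `i₁` maximise `c` on `supp λ`; replacing `λ` by `-λ` if necessary, `λ_{i₁} > 0`.  Evaluate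
  the containment at `ζ = exp(π I / c_{i₁})`: `ζ^{c_{i₁}} = -1`, so `f_{i₁}(ζ) = 0`, while for
  every other `i ∈ supp λ` one has `0 < c_i < c_{i₁}` (injectivity), so
  `Im ζ^{c_i} = sin(π c_i / c_{i₁}) > 0` and `f_i(ζ) = ζ^{a_i}(1 + ζ^{c_i}) ≠ 0`.
* With `Γ(y) = f(ζ)`: `0 = ∏_i f_i(ζ)^{λ⁺_i} = (∏ κ_i^{λ⁺_i}) · ∏_j y_j^{v_j}` forces
  `∏_j y_j^{v_j} = 0`, whence `∏_i f_i(ζ)^{λ⁻_i} = (∏ κ_i^{λ⁻_i}) · ∏_j y_j^{v_j} = 0` — but every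
  factor `f_i(ζ)^{λ⁻_i}` is nonzero. Contradiction.

Sources: GargMakamOliveiraWigderson2019 (arXiv:1904.04299) Prop. 9.8 (monomial curves versus
monomial maps); the binomial variant is folklore multiplicative independence of `1 + x^c`.
-/

-- `Summit.ValiantsHypothesis.ValiantsHypothesis.…` is the tree's mandated single-conjunct layout
-- (Sub = Summit), so the duplicated namespace component is intended.
set_option linter.dupNamespace false

namespace Summit.ValiantsHypothesis.ValiantsHypothesis.Theorems.BinomialElusiveToricBinomialElusive

open scoped BigOperators
open Complex

/-- Left-kernel vectors over `ℤ`: an `m × s` natural matrix with `s < m` has a nonzero integer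
vector `l` with `∑_i l_i E_ij = 0` for all `j` (strong rank condition for the commutative ring `ℤ`). -/
theorem exists_ne_zero_int_leftKernel {m s : ℕ} (hsm : s < m) (E : Fin m → Fin s → ℕ) :
    ∃ l : Fin m → ℤ, l ≠ 0 ∧ ∀ j, ∑ i, l i * (E i j : ℤ) = 0 := by
  let L : (Fin m → ℤ) →ₗ[ℤ] (Fin s → ℤ) :=
    { toFun := fun l j => ∑ i, l i * (E i j : ℤ)
      map_add' := by
        intro x y; funext j
        simp only [Pi.add_apply, add_mul, Finset.sum_add_distrib]
      map_smul' := by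
        intro r x; funext j
        simp only [Pi.smul_apply, smul_eq_mul, RingHom.id_apply, Finset.mul_sum, mul_assoc] }
  have hnotinj : ¬ Function.Injective L := fun h =>
    absurd (le_of_fin_injective ℤ L h) (not_le.mpr hsm)
  rw [injective_iff_map_eq_zero] at hnotinj
  push Not at hnotinj
  obtain ⟨l, hl0, hlne⟩ := hnotinj
  exact ⟨l, hlne, fun j => congr_fun hl0 j⟩

/-- `exp(π I / c)^c = -1` for `c > 0`. -/
theorem exp_pi_mul_I_div_pow_self {c : ℕ} (hc : 0 < c) :
    Complex.exp (Real.pi * I / c) ^ c = -1 := by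
  rw [← Complex.exp_nat_mul]
  have h : (c : ℂ) * (Real.pi * I / c) = Real.pi * I := by
    have : (c : ℂ) ≠ 0 := by exact_mod_cast hc.ne'
    field_simp
  rw [h, Complex.exp_pi_mul_I]

/-- For `0 < k < c`, `1 + exp(π I / c)^k ≠ 0`: its imaginary part is `sin(π k / c) > 0`. -/
theorem one_add_exp_pow_ne_zero {c k : ℕ} (hk : 0 < k) (hkc : k < c) :
    1 + Complex.exp (Real.pi * I / c) ^ k ≠ 0 := by
  rw [← Complex.exp_nat_mul]
  intro h
  have him := congrArg Complex.im h
  have hc : (0 : ℝ) < c := by exact_mod_cast hk.trans hkc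
  have harg : (k : ℂ) * (Real.pi * I / c) = ((k * Real.pi / c : ℝ) : ℂ) * I := by
    push_cast; ring
  rw [harg, Complex.add_im, Complex.one_im, Complex.exp_ofReal_mul_I_im, Complex.zero_im,
    zero_add] at him
  have hpos : 0 < Real.sin (k * Real.pi / c) := by
    apply Real.sin_pos_of_pos_of_lt_pi
    · positivity
    · rw [div_lt_iff₀ hc]
      have hk' : (k : ℝ) < c := by exact_mod_cast hkc
      nlinarith [Real.pi_pos]
  linarith

/-- Product bookkeeping for monomial maps: `∏_i (κ_i ∏_j y_j^{e_ij})^{n_i} =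
(∏_i κ_i^{n_i}) ∏_j y_j^{∑_i e_ij n_i}`. -/
theorem prod_monomial_pow {m s : ℕ} (κ : Fin m → ℂ) (e : Fin m → Fin s → ℕ) (y : Fin s → ℂ)
    (n : Fin m → ℕ) :
    ∏ i, (κ i * ∏ j, y j ^ e i j) ^ n i = (∏ i, κ i ^ n i) * ∏ j, y j ^ (∑ i, e i j * n i) := by
  calc ∏ i, (κ i * ∏ j, y j ^ e i j) ^ n i
      = ∏ i, (κ i ^ n i * ∏ j, y j ^ (e i j * n i)) := by
        refine Finset.prod_congr rfl fun i _ => ?_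
        rw [mul_pow, ← Finset.prod_pow]
        refine congrArg _ (Finset.prod_congr rfl fun j _ => ?_)
        rw [pow_mul]
    _ = (∏ i, κ i ^ n i) * ∏ i, ∏ j, y j ^ (e i j * n i) := Finset.prod_mul_distrib
    _ = (∏ i, κ i ^ n i) * ∏ j, y j ^ (∑ i, e i j * n i) := by
        rw [Finset.prod_comm]
        refine congrArg _ (Finset.prod_congr rfl fun j _ => ?_)
        rw [Finset.prod_pow_eq_pow_sum]

/-- The core contradiction, once a left-kernel vector `l` with a POSITIVE entry at the maximiser
`i₁` of the gap `c` on `supp l` is given. -/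
theorem core_false {m s : ℕ} (a c : Fin m → ℕ) (hc : ∀ i, 0 < c i) (hcinj : Function.Injective c)
    (e : Fin m → Fin s → ℕ) (κ : Fin m → ℂ) (hκ : ∀ i, κ i ≠ 0)
    (hpt : ∀ x : ℂ, ∃ y : Fin s → ℂ, ∀ i, κ i * ∏ j, y j ^ e i j = x ^ a i + x ^ (a i + c i))
    (l : Fin m → ℤ) (hlker : ∀ j, ∑ i, l i * (e i j : ℤ) = 0)
    (i₁ : Fin m) (hi₁ : 0 < l i₁) (hmax : ∀ i, l i ≠ 0 → c i ≤ c i₁) : False := by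
  -- the test point
  obtain ⟨y, hy⟩ := hpt (Complex.exp (Real.pi * I / (c i₁ : ℕ)))
  set ζ : ℂ := Complex.exp (Real.pi * I / (c i₁ : ℕ)) with hζ
  have hζne : ζ ≠ 0 := Complex.exp_ne_zero _
  have hfi₁ : ζ ^ a i₁ + ζ ^ (a i₁ + c i₁) = 0 := by
    rw [pow_add, hζ, exp_pi_mul_I_div_pow_self (hc i₁)]; ring
  have hfne : ∀ i, l i < 0 → ζ ^ a i + ζ ^ (a i + c i) ≠ 0 := by
    intro i hi
    have hne1 : i ≠ i₁ := fun h => by subst h; exact lt_asymm hi hi₁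
    have hlt : c i < c i₁ := lt_of_le_of_ne (hmax i hi.ne) fun h => hne1 (hcinj h)
    rw [pow_add, ← mul_one_add]
    exact mul_ne_zero (pow_ne_zero _ hζne) (one_add_exp_pow_ne_zero (hc i) hlt)
  -- exponent bookkeeping: `∑ e λ⁺ = ∑ e λ⁻`
  have hv : ∀ j, ∑ i, e i j * (l i).toNat = ∑ i, e i j * (-l i).toNat := by
    intro j
    have h2 : ∑ i, ((e i j : ℤ) * ((l i).toNat : ℤ) - (e i j : ℤ) * ((-l i).toNat : ℤ)) = 0 := by
      rw [← hlker j]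
      refine Finset.sum_congr rfl fun i _ => ?_
      rw [← mul_sub, Int.toNat_sub_toNat_neg, mul_comm]
    rw [Finset.sum_sub_distrib, sub_eq_zero] at h2
    exact_mod_cast h2
  have hyprod : ∀ n : Fin m → ℕ, ∏ i, (ζ ^ a i + ζ ^ (a i + c i)) ^ n i
      = (∏ i, κ i ^ n i) * ∏ j, y j ^ (∑ i, e i j * n i) := by
    intro n
    rw [← prod_monomial_pow]
    exact Finset.prod_congr rfl fun i _ => by rw [hy i]
  have hκprod : ∀ n : Fin m → ℕ, (∏ i, κ i ^ n i) ≠ 0 := fun n =>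
    Finset.prod_ne_zero_iff.mpr fun i _ => pow_ne_zero _ (hκ i)
  -- positive side vanishes
  have hplus : ∏ i, (ζ ^ a i + ζ ^ (a i + c i)) ^ (l i).toNat = 0 := by
    apply Finset.prod_eq_zero (Finset.mem_univ i₁)
    rw [hfi₁, zero_pow]
    have : 0 < (l i₁).toNat := Int.lt_toNat.mpr (by simpa using hi₁)
    exact this.ne'
  -- negative side does not vanish
  have hminus : ∏ i, (ζ ^ a i + ζ ^ (a i + c i)) ^ (-l i).toNat ≠ 0 := by
    rw [Finset.prod_ne_zero_iff]
    intro i _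
    by_cases hi : l i < 0
    · exact pow_ne_zero _ (hfne i hi)
    · have h0 : (-l i).toNat = 0 := by rw [Int.toNat_eq_zero]; omega
      rw [h0, pow_zero]; exact one_ne_zero
  rw [hyprod] at hplus hminus
  have hY : ∏ j, y j ^ (∑ i, e i j * (l i).toNat) = 0 :=
    (mul_eq_zero.mp hplus).resolve_left (hκprod _)
  apply hminus
  have hexp : (fun j => y j ^ (∑ i, e i j * (-l i).toNat))
      = fun j => y j ^ (∑ i, e i j * (l i).toNat) := by
    funext j; rw [hv j]
  rw [show (∏ j, y j ^ (∑ i, e i j * (-l i).toNat)) = ∏ j, y j ^ (∑ i, e i j * (l i).toNat) from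
    Finset.prod_congr rfl fun j _ => by rw [hv j], hY, mul_zero]

/-- **ToricBinomialElusive** (item stmt-ValiantsHypothesis-7394 of route BinomialElusive): if
`s < m`, `c : Fin m → ℕ` is injective with `c_i > 0`, and each `Γ_i ∈ ℂ[z_1, …, z_s]` has at most
one monomial, then the binomial curve `x ↦ (x^{a_i} + x^{a_i + c_i})_i` is not contained in
`Γ(ℂ^s)`. -/
theorem toricBinomialElusive_proof :
    Summit.ValiantsHypothesis.ValiantsHypothesis.Theses.BinomialElusive.ToricBinomialElusive := by
  unfold Summit.ValiantsHypothesis.ValiantsHypothesis.Theses.BinomialElusive.ToricBinomialElusive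
  intro m s hsm a c hc hcinj Γ hΓ hsub
  -- monomial normal form of each coordinate
  choose e κ hΓe using fun i =>
    Summit.ValiantsHypothesis.ValiantsHypothesis.Theorems.TwoProducts.RaySeries.exists_eq_monomial_of_card_support_le_one
      (Γ i) (hΓ i)
  have heval : ∀ (y : Fin s → ℂ) (i : Fin m),
      MvPolynomial.eval y (Γ i) = κ i * ∏ j, y j ^ e i j := by
    intro y i
    rw [hΓe i, MvPolynomial.eval_monomial, Finsupp.prod_fintype]
    intro j; exact pow_zero _
  have hpt : ∀ x : ℂ, ∃ y : Fin s → ℂ, ∀ i, κ i * ∏ j, y j ^ e i j = x ^ a i + x ^ (a i + c i) := by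
    intro x
    obtain ⟨y, hy⟩ := hsub (Set.mem_range_self x)
    exact ⟨y, fun i => by rw [← heval]; exact congr_fun hy i⟩
  -- nonzero coefficients (point `x = 1`)
  have hκ : ∀ i, κ i ≠ 0 := by
    intro i h0
    obtain ⟨y, hy⟩ := hpt 1
    have := hy i
    rw [h0, zero_mul, one_pow, one_pow] at this
    norm_num at this
  -- integer left-kernel vector of the exponent matrix
  obtain ⟨l, hlne, hlker⟩ := exists_ne_zero_int_leftKernel hsm (fun i j => e i j)
  -- maximiser of `c` on the support of `l`
  classical
  have hne : (Finset.univ.filter fun i => l i ≠ 0).Nonempty := by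
    obtain ⟨i, hi⟩ := Function.ne_iff.mp hlne
    exact ⟨i, Finset.mem_filter.mpr ⟨Finset.mem_univ i, hi⟩⟩
  obtain ⟨i₁, hi₁mem, hi₁max⟩ := Finset.exists_max_image _ c hne
  have hl₁ : l i₁ ≠ 0 := (Finset.mem_filter.mp hi₁mem).2
  have hmax : ∀ i, l i ≠ 0 → c i ≤ c i₁ := fun i hi =>
    hi₁max i (Finset.mem_filter.mpr ⟨Finset.mem_univ i, hi⟩)
  rcases lt_or_gt_of_ne hl₁ with hneg | hpos
  · -- use `-l`
    refine core_false a c hc hcinj (fun i j => e i j) κ hκ hpt (-l) (fun j => ?_) i₁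
      (by simpa using hneg) (fun i hi => hmax i (by simpa using hi))
    simp only [Pi.neg_apply, neg_mul, Finset.sum_neg_distrib, hlker j, neg_zero]
  · exact core_false a c hc hcinj (fun i j => e i j) κ hκ hpt l hlker i₁ hpos hmax

end Summit.ValiantsHypothesis.ValiantsHypothesis.Theorems.BinomialElusiveToricBinomialElusive
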